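import Summits.Ventures.Crystal3D.Theorems.StickyWulffConstantNoReconstructionGainTwoFamilyCount
import HarnessLib

/-!
# Two Barlow families at once: the per-ball count at a lattice ball

HONEST FRAMING. Part of the venture `Summits/Ventures/Crystal3D` (cell `crystal3d-full`), helper
`--supports` the crux `NoReconstructionGain` (stmt-Ventures-19144, route
`route-Ventures-StickyWulffConstant`), line `adhesion`; continuation of `…TwoFamilyLocal` /
`…TwoFamilyCount`.

The rung `twoFamilyBarlowFilm_adhesion` (`…TwoFamilyFilm`) treats films whose balls are Barlow
positions of the basal family (`B = Λ₀ ∪ (Λ₀ ± w)`) or of the family obtained from it by the half-turn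
`R` about `t` (`R B = Λ₀ ∪ (Λ₀ ± R w)`), at normals `ν` inside BOTH `54.7°`-cones
(`ν₃² > 1/3`, `(R ν)₃² > 1/3`), under the `ν`-height potential.  Coset balls only see their own
family (`crossCoset_dist_ne_one`) and are handled by `basal_noGainPotential`; this file proves the
inequality (T2) at a LATTICE ball `q`, whose partners may come from all `24` directions
(`12` bonds, the twin-hollow triples `±{A, B₁, B₂}` of the basal family and `±R{A, B₁, B₂}`):

* `twoFamily_lattice_noGainPotential` — `#below + #plug ≤ (12 − deg q) + #above`.

Proof (the accounting of RUNGS-g8 §2.7).  With `c = −sign ν₃` (`= −sign (Rν)₃`, forced by the bond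
`t`, polar for both families) every `ν`-negative partner direction other than `±(u − v)` is one of the
eleven vectors `c·{t, t−u, t−v, u, v, A, B₁, B₂, RA, RB₁, RB₂}`; a twin-hollow partner forbids the
two adjacent bond slots of its family (squared distances `1/3`), and `B₁`, `R B₂` forbid each other
(`2/9`); a `2¹¹`-case boolean count (`slots_count_le_five`) then bounds the occupied ones by `5`, so
together with the line `±(u − v)` (the only possibly `ν`-level direction) all non-`ν`-above partners
lie on `≤ 6` lines through `q`, and `antipodal_noGainPotential_of_above` concludes.
WHAT THIS IS NOT: the film statement (next file); rung F-C1 not moved.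
-/

noncomputable section

namespace Summit.Ventures.Crystal3D.Theorems

open Summit.Ventures.Crystal3D Finset
open Literature.MathematicalPhysics.StatisticalMechanics (barlowPos barlowStacking fccStacking
  barlowOffset constHagg haggLabel_const barlowPos_apply_zero barlowPos_apply_one barlowPos_apply_two
  orderedContacts contactDeficiency)
open scoped InnerProductSpace

/-! ### The per-ball lemma at a lattice ball -/

/-- **(T2) at a LATTICE ball of a two-family Barlow film under the `ν`-height potential.**
`X` a unit packing, `P ⊆ X`, `q` a ball all of whose partners `x` have `x − q` in
`Λ₀ ∪ (Λ₀ ± w) ∪ R⁻¹(Λ₀ ± w)` (`R` the half-turn about `t`), `ν` in both cones, `Φ` ordered like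
`⟪·, ν⟫` on the film partners, substrate partners strictly `ν`-below.  Then
`#below + #plug ≤ (12 − deg q) + #above`. -/
theorem twoFamily_lattice_noGainPotential (X P : Finset (EuclideanSpace ℝ (Fin 3)))
    (hX : ∀ p ∈ X, ∀ q ∈ X, p ≠ q → 1 ≤ dist p q) (hPX : P ⊆ X)
    (q : EuclideanSpace ℝ (Fin 3)) (Φ : EuclideanSpace ℝ (Fin 3) → ℤ)
    (ν : EuclideanSpace ℝ (Fin 3)) (hν : ‖ν‖ = 1) (hν3 : 1 / 3 < ν 2 ^ 2)
    (R : EuclideanSpace ℝ (Fin 3) ≃ₗᵢ[ℝ] EuclideanSpace ℝ (Fin 3))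
    (hR : ∀ x, R x = (2 * ⟪x, barlowPos 1 (Real.sqrt (2 / 3)) constHagg 1 0 0⟫_ℝ) •
      barlowPos 1 (Real.sqrt (2 / 3)) constHagg 1 0 0 - x)
    (hν3' : 1 / 3 < (R ν) 2 ^ 2)
    (hlt : ∀ x ∈ X \ P, dist q x = 1 → (Φ x < Φ q ↔ ⟪x, ν⟫_ℝ < ⟪q, ν⟫_ℝ))
    (heq : ∀ x ∈ X \ P, dist q x = 1 → (Φ x = Φ q ↔ ⟪x, ν⟫_ℝ = ⟪q, ν⟫_ℝ))
    (hplug : ∀ p ∈ P, dist q p = 1 → ⟪p, ν⟫_ℝ < ⟪q, ν⟫_ℝ)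
    (hdir : ∀ x ∈ X, dist q x = 1 →
      x - q ∈ fccStacking 1 (Real.sqrt (2 / 3)) ∨
      x - q - barlowOffset 1 ∈ fccStacking 1 (Real.sqrt (2 / 3)) ∨
      x - q + barlowOffset 1 ∈ fccStacking 1 (Real.sqrt (2 / 3)) ∨
      R (x - q) - barlowOffset 1 ∈ fccStacking 1 (Real.sqrt (2 / 3)) ∨
      R (x - q) + barlowOffset 1 ∈ fccStacking 1 (Real.sqrt (2 / 3))) :
    (((X \ P).filter fun x => dist q x = 1 ∧ Φ x < Φ q).card : ℤ)
        + ((P.filter fun p => dist q p = 1).card : ℤ)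
      ≤ (12 - ((X.filter fun x => dist q x = 1).card : ℤ))
        + (((X \ P).filter fun x => dist q x = 1 ∧ Φ q < Φ x).card : ℤ) := by
  classical
  -- a linear function is midpoint-affine (stated first: cheap context)
  have hconv : ∀ z : EuclideanSpace ℝ (Fin 3), 2 * ⟪q, ν⟫_ℝ ≤ ⟪q + z, ν⟫_ℝ + ⟪q - z, ν⟫_ℝ := by
    intro z; rw [inner_add_left, inner_sub_left]; exact le_of_eq (by ring)
  -- three sign manipulations on abstract reals (keeps `nlinarith` away from the vector atoms)
  have aux1 : ∀ a b g : ℝ, 0 < g → 0 < a * (g * b) → 0 < a * b := by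
    intro a b g hg h; by_contra hab; push Not at hab
    nlinarith [mul_nonpos_iff.2 (Or.inl ⟨hg.le, hab⟩)]
  have aux2 : ∀ a n r : ℝ, 0 < a * r → 0 < n * r → 0 < a * n := by
    intro a n r h1 h2; by_contra han; push Not at han
    nlinarith [mul_pos h1 h2, mul_nonpos_iff.2 (Or.inr ⟨han, sq_nonneg r⟩)]
  have aux3 : ∀ a b : ℝ, 0 < a * b → a < 0 → b < 0 := by
    intro a b h ha; by_contra hb; push Not at hb
    nlinarith [mul_nonpos_iff.2 (Or.inr ⟨ha.le, hb⟩)]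
  have h0Λ : (0 : EuclideanSpace ℝ (Fin 3)) ∈ fccStacking 1 (Real.sqrt (2 / 3)) :=
    ⟨0, 0, 0, by simp [barlowPos]⟩
  -- names for the seven vectors and the layer height (made opaque below: the unifier must never
  -- unfold two different Barlow positions against each other)
  set t : EuclideanSpace ℝ (Fin 3) := barlowPos 1 (Real.sqrt (2 / 3)) constHagg 1 0 0 with htdef
  set u : EuclideanSpace ℝ (Fin 3) := barlowPos 1 (Real.sqrt (2 / 3)) constHagg 0 1 0 with hudef
  set v : EuclideanSpace ℝ (Fin 3) := barlowPos 1 (Real.sqrt (2 / 3)) constHagg 0 0 1 with hvdef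
  set w : EuclideanSpace ℝ (Fin 3) := barlowOffset 1 with hwdef
  set A : EuclideanSpace ℝ (Fin 3) := barlowPos 1 (Real.sqrt (2 / 3)) constHagg 1 (-1) (-1) + w with hAdef
  set B₁ : EuclideanSpace ℝ (Fin 3) := barlowPos 1 (Real.sqrt (2 / 3)) constHagg 1 0 (-1) + w with hB₁def
  set B₂ : EuclideanSpace ℝ (Fin 3) := barlowPos 1 (Real.sqrt (2 / 3)) constHagg 1 (-1) 0 + w with hB₂def
  obtain ⟨hgt, hhgt⟩ : ∃ h : ℝ, h = Real.sqrt (2 / 3) := ⟨_, rfl⟩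
  -- transparent phase: every concrete computation
  have hh2 : hgt ^ 2 = 2 / 3 := by rw [hhgt, Real.sq_sqrt]; norm_num
  have hgt_pos : 0 < hgt := by rw [hhgt]; exact Real.sqrt_pos.2 (by norm_num)
  have hnt : ‖t‖ = 1 := norm_t
  have hw2 : w 2 = 0 := by simp [hwdef, barlowOffset]
  have ht2 : t 2 = hgt := by rw [hhgt]; simp [htdef, barlowPos_apply_two]
  have hu2 : u 2 = 0 := by simp [hudef, barlowPos_apply_two]
  have hv2 : v 2 = 0 := by simp [hvdef, barlowPos_apply_two]
  have hA2 : A 2 = hgt := by rw [hhgt, hAdef, PiLp.add_apply, barlowPos_apply_two, hw2]; simp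
  have hB₁2 : B₁ 2 = hgt := by rw [hhgt, hB₁def, PiLp.add_apply, barlowPos_apply_two, hw2]; simp
  have hB₂2 : B₂ 2 = hgt := by rw [hhgt, hB₂def, PiLp.add_apply, barlowPos_apply_two, hw2]; simp
  have htu2 : (t - u) 2 = hgt := by rw [PiLp.sub_apply, ht2, hu2, sub_zero]
  have htv2 : (t - v) 2 = hgt := by rw [PiLp.sub_apply, ht2, hv2, sub_zero]
  have hRR : ∀ x, R (R x) = x := halfTurn_halfTurn R hR
  have hRt : R t = t := halfTurn_t R hR
  have hRu : R u = t - u := halfTurn_u R hR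
  have hRv : R v = t - v := halfTurn_v R hR
  have hRν1 : ‖R ν‖ = 1 := by rw [LinearIsometryEquiv.norm_map, hν]
  have e_uv : barlowPos 1 (Real.sqrt (2 / 3)) constHagg 0 1 (-1) = u - v := by
    rw [hudef, hvdef, barlowPos_fcc_linear 1 _ 0 1 (-1)]; push_cast; module
  have e_ut : barlowPos 1 (Real.sqrt (2 / 3)) constHagg (-1) 1 0 = -(t - u) := by
    rw [htdef, hudef, barlowPos_fcc_linear 1 _ (-1) 1 0]; push_cast; module
  have e_vt : barlowPos 1 (Real.sqrt (2 / 3)) constHagg (-1) 0 1 = -(t - v) := by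
    rw [htdef, hvdef, barlowPos_fcc_linear 1 _ (-1) 0 1]; push_cast; module
  obtain ⟨nA1, nA2, nB11, nB12, nB21, nB22⟩ :
      ‖A - (t - u)‖ ^ 2 = 1 / 3 ∧ ‖A - (t - v)‖ ^ 2 = 1 / 3 ∧ ‖B₁ - t‖ ^ 2 = 1 / 3 ∧
      ‖B₁ - (t - v)‖ ^ 2 = 1 / 3 ∧ ‖B₂ - t‖ ^ 2 = 1 / 3 ∧ ‖B₂ - (t - u)‖ ^ 2 = 1 / 3 :=
    twinHollow_block_norms
  have h29 : ‖B₁ - R B₂‖ ^ 2 = 2 / 9 := norm_sq_twinHollow_sub_halfTurn R hR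
  clear_value t u v w A B₁ B₂
  -- the key sign fact: every direction of height `+hgt` (in either frame) has `⟪e, ν⟫` of the sign of `ν₂`
  have hsame : 0 < ν 2 * (R ν) 2 := by
    have h1 := basal_polar_sign ν t hν hnt hν3 (by rw [ht2, hh2])
    have h2 := basal_polar_sign (R ν) (R t) hRν1 (by rw [LinearIsometryEquiv.norm_map, hnt]) hν3'
      (by rw [hRt, ht2, hh2])
    rw [LinearIsometryEquiv.inner_map_map, hRt, ht2] at h2
    rw [ht2] at h1
    have h1' : 0 < ν 2 * ⟪t, ν⟫_ℝ := by rw [mul_comm]; exact aux1 _ _ _ hgt_pos h1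
    have h2' : 0 < (R ν) 2 * ⟪t, ν⟫_ℝ := by rw [mul_comm]; exact aux1 _ _ _ hgt_pos h2
    exact aux2 _ _ _ h1' h2'
  have hkey : ∀ e : EuclideanSpace ℝ (Fin 3), ‖e‖ = 1 → (e 2 = hgt ∨ (R e) 2 = hgt) →
      0 < ⟪e, ν⟫_ℝ * ν 2 := by
    intro e he h
    rcases h with h | h
    · have := basal_polar_sign ν e hν he hν3 (by rw [h, hh2])
      rw [h] at this
      exact aux1 _ _ _ hgt_pos this
    · have h2 := basal_polar_sign (R ν) (R e) hRν1 (by rw [LinearIsometryEquiv.norm_map, he]) hν3'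
        (by rw [h, hh2])
      rw [LinearIsometryEquiv.inner_map_map, h] at h2
      have h2' : 0 < ⟪e, ν⟫_ℝ * (R ν) 2 := aux1 _ _ _ hgt_pos h2
      have hs' : 0 < ν 2 * (R ν) 2 := hsame
      exact aux2 _ _ _ h2' hs'
  -- the sign `c = −sign ν₂`
  obtain ⟨c, hcdef⟩ : ∃ c : ℝ, c = if ν 2 < 0 then 1 else -1 := ⟨_, rfl⟩
  have hc_abs : |c| = 1 := by rw [hcdef]; split_ifs <;> simp
  have hfit : ∀ e d : EuclideanSpace ℝ (Fin 3), ‖e‖ = 1 → (e 2 = hgt ∨ (R e) 2 = hgt) →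
      (d = e ∨ d = -e) → ⟪d, ν⟫_ℝ < 0 → d = c • e := by
    intro e d he h hd hneg
    have hk := hkey e he h
    rcases hd with rfl | rfl
    · have : ν 2 < 0 := aux3 _ _ hk hneg
      rw [hcdef, if_pos this, one_smul]
    · rw [inner_neg_left, neg_lt_zero] at hneg
      have hk' : 0 < ν 2 := by
        by_contra hle; push Not at hle
        have := mul_nonpos_iff.2 (Or.inl ⟨hneg.le, hle⟩)
        exact absurd hk (not_lt.2 this)
      have : ¬ ν 2 < 0 := not_lt.2 hk'.le
      rw [hcdef, if_neg this, neg_one_smul]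
  -- two balls of `X` at relative position `c•a`, `c•b` with `0 < ‖a − b‖² < 1` cannot coexist
  have hforbid : ∀ a b : EuclideanSpace ℝ (Fin 3), 0 < ‖a - b‖ ^ 2 → ‖a - b‖ ^ 2 < 1 →
      q + c • a ∈ X → q + c • b ∈ X → False := by
    intro a b h0 h1 ha hb
    have hd : dist (q + c • a) (q + c • b) = ‖a - b‖ := by
      rw [dist_eq_norm, show q + c • a - (q + c • b) = c • (a - b) by module, norm_smul,
        Real.norm_eq_abs, hc_abs, one_mul]
    have hne : q + c • a ≠ q + c • b := by
      intro e
      rw [← hd, e, dist_self, sq, mul_zero] at h0; exact lt_irrefl _ h0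
    have := hX _ ha _ hb hne
    rw [hd] at this
    have hsq : 1 ≤ ‖a - b‖ ^ 2 := by
      rw [sq]; exact le_trans (by norm_num) (mul_le_mul this this zero_le_one (norm_nonneg _))
    exact (not_lt.2 hsq) h1
  -- classification of the partner directions
  have hclass : ∀ x ∈ X, dist q x = 1 →
      (x - q = u - v ∨ x - q = -(u - v)) ∨
      ∃ e : EuclideanSpace ℝ (Fin 3),
        (e = t ∨ e = t - u ∨ e = t - v ∨ e = u ∨ e = v ∨ e = A ∨ e = B₁ ∨ e = B₂ ∨
          e = R A ∨ e = R B₁ ∨ e = R B₂) ∧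
        ‖e‖ = 1 ∧ (e 2 = hgt ∨ (R e) 2 = hgt) ∧ (x - q = e ∨ x - q = -e) := by
    intro x hx hd
    have hn : ‖x - q‖ = 1 := by rw [← dist_eq_norm, dist_comm]; exact hd
    have hnorm_of : ∀ e : EuclideanSpace ℝ (Fin 3), (x - q = e ∨ x - q = -e) → ‖e‖ = 1 := by
      intro e he
      rcases he with he | he; · rw [← he, hn]
      rw [show e = -(x - q) by rw [he, neg_neg], norm_neg, hn]
    -- the three twin-hollow cases, once and for all
    have hT : ∀ d : EuclideanSpace ℝ (Fin 3), d - w ∈ fccStacking 1 (Real.sqrt (2 / 3)) → ‖d‖ = 1 →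
        d = A ∨ d = B₁ ∨ d = B₂ := by
      intro d hdw hdn
      rw [hwdef] at hdw
      obtain ⟨c', hc', hcx⟩ := fcc_coset_unit_vectors d hdw hdn
      rw [← hwdef] at hcx
      simp only [List.mem_cons, List.mem_nil_iff, or_false] at hc'
      rcases hc' with rfl | rfl | rfl
      exacts [Or.inl (by rw [hcx, hAdef]), Or.inr (Or.inl (by rw [hcx, hB₁def])),
        Or.inr (Or.inr (by rw [hcx, hB₂def]))]
    rcases hdir x hx hd with hΛ0 | hup | hdown | hRup | hRdown
    · -- a bond vector
      obtain ⟨c', hc', hcx⟩ := fcc_unit_directions 0 (x - q) h0Λ hΛ0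
        (by rw [dist_eq_norm, zero_sub, norm_neg, hn])
      rw [zero_add, zero_sub] at hcx
      simp only [List.mem_cons, List.mem_nil_iff, or_false] at hc'
      rcases hc' with rfl | rfl | rfl | rfl | rfl | rfl
      · -- `u`: polar for the second family
        right; rw [← hudef] at hcx
        exact ⟨u, by simp, hnorm_of u hcx, Or.inr (by rw [hRu, htu2]), hcx⟩
      · right; rw [← hvdef] at hcx
        exact ⟨v, by simp, hnorm_of v hcx, Or.inr (by rw [hRv, htv2]), hcx⟩
      · right; rw [← htdef] at hcx
        exact ⟨t, by simp, hnorm_of t hcx, Or.inl ht2, hcx⟩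
      · -- `u − v`
        left; rw [e_uv] at hcx; exact hcx
      · -- `u − t = −(t − u)`
        right; rw [e_ut, neg_neg] at hcx
        exact ⟨t - u, by simp, hnorm_of (t - u) hcx.symm, Or.inl htu2, hcx.symm⟩
      · right; rw [e_vt, neg_neg] at hcx
        exact ⟨t - v, by simp, hnorm_of (t - v) hcx.symm, Or.inl htv2, hcx.symm⟩
    · -- a twin hollow of the basal family, pointing up
      right
      rcases hT (x - q) hup hn with h | h | h
      · exact ⟨A, by simp, hnorm_of A (Or.inl h), Or.inl hA2, Or.inl h⟩
      · exact ⟨B₁, by simp, hnorm_of B₁ (Or.inl h), Or.inl hB₁2, Or.inl h⟩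
      · exact ⟨B₂, by simp, hnorm_of B₂ (Or.inl h), Or.inl hB₂2, Or.inl h⟩
    · -- a twin hollow of the basal family, pointing down
      right
      have hneg' : -(x - q) - w ∈ fccStacking 1 (Real.sqrt (2 / 3)) := by
        rw [show -(x - q) - w = -(x - q + w) by abel]; exact fcc_neg_mem hdown
      have hT' := hT (-(x - q)) hneg' (by rw [norm_neg, hn])
      simp only [neg_eq_iff_eq_neg] at hT'
      rcases hT' with h | h | h
      · exact ⟨A, by simp, hnorm_of A (Or.inr h), Or.inl hA2, Or.inr h⟩
      · exact ⟨B₁, by simp, hnorm_of B₁ (Or.inr h), Or.inl hB₁2, Or.inr h⟩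
      · exact ⟨B₂, by simp, hnorm_of B₂ (Or.inr h), Or.inl hB₂2, Or.inr h⟩
    · -- a twin hollow of the second family, pointing up along its axis
      right
      have hn' : ‖R (x - q)‖ = 1 := by rw [LinearIsometryEquiv.norm_map, hn]
      have hxq : x - q = R (R (x - q)) := (hRR _).symm
      rcases hT (R (x - q)) hRup hn' with h | h | h
      · have e : x - q = R A := by rw [hxq, h]
        exact ⟨R A, by simp, hnorm_of _ (Or.inl e), Or.inr (by rw [hRR, hA2]), Or.inl e⟩
      · have e : x - q = R B₁ := by rw [hxq, h]
        exact ⟨R B₁, by simp, hnorm_of _ (Or.inl e), Or.inr (by rw [hRR, hB₁2]), Or.inl e⟩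
      · have e : x - q = R B₂ := by rw [hxq, h]
        exact ⟨R B₂, by simp, hnorm_of _ (Or.inl e), Or.inr (by rw [hRR, hB₂2]), Or.inl e⟩
    · -- a twin hollow of the second family, pointing down along its axis
      right
      have hn' : ‖-R (x - q)‖ = 1 := by rw [norm_neg, LinearIsometryEquiv.norm_map, hn]
      have hneg' : -R (x - q) - w ∈ fccStacking 1 (Real.sqrt (2 / 3)) := by
        rw [show -R (x - q) - w = -(R (x - q) + w) by abel]; exact fcc_neg_mem hRdown
      have hxq : x - q = R (R (x - q)) := (hRR _).symm
      have hT' := hT (-R (x - q)) hneg' hn'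
      simp only [neg_eq_iff_eq_neg] at hT'
      rcases hT' with h | h | h
      · have e : x - q = -R A := by rw [hxq, h, map_neg]
        exact ⟨R A, by simp, hnorm_of _ (Or.inr e), Or.inr (by rw [hRR, hA2]), Or.inr e⟩
      · have e : x - q = -R B₁ := by rw [hxq, h, map_neg]
        exact ⟨R B₁, by simp, hnorm_of _ (Or.inr e), Or.inr (by rw [hRR, hB₁2]), Or.inr e⟩
      · have e : x - q = -R B₂ := by rw [hxq, h, map_neg]
        exact ⟨R B₂, by simp, hnorm_of _ (Or.inr e), Or.inr (by rw [hRR, hB₂2]), Or.inr e⟩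
  -- the occupied ν-negative directions other than `±(u − v)`
  obtain ⟨Wocc, hWocc⟩ : ∃ S : Finset (EuclideanSpace ℝ (Fin 3)),
      S = (X.filter fun x => dist q x = 1 ∧ ⟪x - q, ν⟫_ℝ < 0 ∧ x - q ≠ u - v ∧
        x - q ≠ -(u - v)).image (fun x => x - q) := ⟨_, rfl⟩
  have hWocc_card : Wocc.card ≤ 5 := by
    obtain ⟨L, hL⟩ : ∃ L : List (EuclideanSpace ℝ (Fin 3)), L =
      [c • t, c • (t - u), c • (t - v), c • u, c • v, c • A, c • B₁, c • B₂, c • R A, c • R B₁,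
        c • R B₂] := ⟨_, rfl⟩
    obtain ⟨occ, hocc⟩ : ∃ o : EuclideanSpace ℝ (Fin 3) → Bool, o = fun d => decide (q + d ∈ X) :=
      ⟨_, rfl⟩
    have hWsub : Wocc ⊆ (L.filter occ).toFinset := by
      intro d hd
      rw [hWocc, mem_image] at hd
      obtain ⟨x, hx, rfl⟩ := hd
      obtain ⟨hxX, hdist, hneg, hne1, hne2⟩ := mem_filter.1 hx
      rw [List.mem_toFinset, List.mem_filter]
      refine ⟨?_, by rw [hocc]; simp only [add_sub_cancel, decide_eq_true_eq]; exact hxX⟩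
      rcases hclass x hxX hdist with (h | h) | ⟨e, heL, he1, he2, hxe⟩
      · exact absurd h hne1
      · exact absurd h hne2
      · rw [hfit e (x - q) he1 he2 hxe hneg, hL]
        rcases heL with rfl | rfl | rfl | rfl | rfl | rfl | rfl | rfl | rfl | rfl | rfl
        · exact List.Mem.head _
        · exact List.Mem.tail _ (List.Mem.head _)
        · exact List.Mem.tail _ (List.Mem.tail _ (List.Mem.head _))
        · exact List.Mem.tail _ (List.Mem.tail _ (List.Mem.tail _ (List.Mem.head _)))
        · exact List.Mem.tail _ (List.Mem.tail _ (List.Mem.tail _ (List.Mem.tail _ (List.Mem.head _))))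
        · exact List.Mem.tail _ (List.Mem.tail _ (List.Mem.tail _ (List.Mem.tail _ (List.Mem.tail _ (List.Mem.head _)))))
        · exact List.Mem.tail _ (List.Mem.tail _ (List.Mem.tail _ (List.Mem.tail _ (List.Mem.tail _ (List.Mem.tail _ (List.Mem.head _))))))
        · exact List.Mem.tail _ (List.Mem.tail _ (List.Mem.tail _ (List.Mem.tail _ (List.Mem.tail _ (List.Mem.tail _ (List.Mem.tail _ (List.Mem.head _)))))))
        · exact List.Mem.tail _ (List.Mem.tail _ (List.Mem.tail _ (List.Mem.tail _ (List.Mem.tail _ (List.Mem.tail _ (List.Mem.tail _ (List.Mem.tail _ (List.Mem.head _))))))))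
        · exact List.Mem.tail _ (List.Mem.tail _ (List.Mem.tail _ (List.Mem.tail _ (List.Mem.tail _ (List.Mem.tail _ (List.Mem.tail _ (List.Mem.tail _ (List.Mem.tail _ (List.Mem.head _)))))))))
        · exact List.Mem.tail _ (List.Mem.tail _ (List.Mem.tail _ (List.Mem.tail _ (List.Mem.tail _ (List.Mem.tail _ (List.Mem.tail _ (List.Mem.tail _ (List.Mem.tail _ (List.Mem.tail _ (List.Mem.head _))))))))))
    -- blocking
    have hRsub : ∀ a b : EuclideanSpace ℝ (Fin 3), ‖a - b‖ ^ 2 = 1 / 3 → ‖R a - R b‖ ^ 2 = 1 / 3 := by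
      intro a b h; rw [← map_sub, LinearIsometryEquiv.norm_map, h]
    have hb : ∀ a b : EuclideanSpace ℝ (Fin 3), ‖a - b‖ ^ 2 = 1 / 3 →
        occ (c • a) = true → occ (c • b) = false := by
      intro a b h ha
      rw [hocc] at ha ⊢
      simp only [decide_eq_true_eq] at ha; simp only [decide_eq_false_iff_not]
      exact fun hb' => hforbid a b (by rw [h]; norm_num) (by rw [h]; norm_num) ha hb'
    have hcross : occ (c • B₁) = true → occ (c • R B₂) = false := by
      intro ha
      rw [hocc] at ha ⊢
      simp only [decide_eq_true_eq] at ha; simp only [decide_eq_false_iff_not]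
      exact fun hb' => hforbid B₁ (R B₂) (by rw [h29]; norm_num) (by rw [h29]; norm_num) ha hb'
    have hRA_u : ‖R A - u‖ ^ 2 = 1 / 3 := by
      have : u = R (t - u) := by rw [map_sub, hRt, hRu]; abel
      rw [this]; exact hRsub _ _ nA1
    have hRA_v : ‖R A - v‖ ^ 2 = 1 / 3 := by
      have : v = R (t - v) := by rw [map_sub, hRt, hRv]; abel
      rw [this]; exact hRsub _ _ nA2
    have hRB1_t : ‖R B₁ - t‖ ^ 2 = 1 / 3 := by
      conv_lhs => rw [← hRt]
      exact hRsub _ _ nB11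
    have hRB1_v : ‖R B₁ - v‖ ^ 2 = 1 / 3 := by
      have : v = R (t - v) := by rw [map_sub, hRt, hRv]; abel
      rw [this]; exact hRsub _ _ nB12
    have hRB2_t : ‖R B₂ - t‖ ^ 2 = 1 / 3 := by
      conv_lhs => rw [← hRt]
      exact hRsub _ _ nB21
    have hRB2_u : ‖R B₂ - u‖ ^ 2 = 1 / 3 := by
      have : u = R (t - u) := by rw [map_sub, hRt, hRu]; abel
      rw [this]; exact hRsub _ _ nB22
    have hcount := slots_count_le_five (occ (c • t)) (occ (c • (t - u))) (occ (c • (t - v)))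
      (occ (c • u)) (occ (c • v)) (occ (c • A)) (occ (c • B₁)) (occ (c • B₂)) (occ (c • R A))
      (occ (c • R B₁)) (occ (c • R B₂))
      (hb _ _ nA1) (hb _ _ nA2) (hb _ _ nB11) (hb _ _ nB12) (hb _ _ nB21) (hb _ _ nB22)
      (hb _ _ hRA_u) (hb _ _ hRA_v) (hb _ _ hRB1_t) (hb _ _ hRB1_v) (hb _ _ hRB2_t) (hb _ _ hRB2_u)
      hcross
    have hlen : (L.filter occ).length ≤ 5 := by
      rw [hL]
      simp only [length_filter_cons_toNat, List.filter_nil, List.length_nil]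
      omega
    exact ((card_le_card hWsub).trans (List.toFinset_card_le _)).trans hlen
  -- the set of line generators
  obtain ⟨W, hW⟩ : ∃ S : Finset (EuclideanSpace ℝ (Fin 3)), S = insert (u - v) Wocc := ⟨_, rfl⟩
  have hW1 : W.card ≤ Wocc.card + 1 := by rw [hW]; exact card_insert_le _ _
  have hWcard : W.card ≤ 6 := hW1.trans (Nat.add_le_add_right hWocc_card 1)
  -- apply the antipodal lemma with `R` = film partners that are not ν-above, `f = ⟪·,ν⟫`
  -- (no `linarith`/`set` from here on: this context is too expensive for their preprocessing)
  obtain ⟨Rset, hRset⟩ : ∃ S : Finset (EuclideanSpace ℝ (Fin 3)),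
      S = (X \ P).filter fun x => ⟪x, ν⟫_ℝ ≤ ⟪q, ν⟫_ℝ := ⟨_, rfl⟩
  have hRsub' : Rset ⊆ X \ P := by rw [hRset]; exact filter_subset _ _
  refine antipodal_noGainPotential_of_above X P Rset hPX hRsub' q Φ (fun y => ⟪y, ν⟫_ℝ)
    (fun x hx hd => ?_) (fun x hx hd => hlt x (hRsub' hx) hd) (fun x hx hd => heq x (hRsub' hx) hd)
    hplug hconv W hWcard (fun x hx hd hxR => ?_)
  · -- outside `Rset`: ν-above, hence Φ-above
    have hxQ : x ∈ X \ P := (mem_sdiff.1 hx).1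
    have hnot : ¬ ⟪x, ν⟫_ℝ ≤ ⟪q, ν⟫_ℝ := fun hle =>
      (mem_sdiff.1 hx).2 (by rw [hRset]; exact mem_filter.2 ⟨hxQ, hle⟩)
    have h1 : ¬ Φ x < Φ q := fun hl => hnot ((hlt x hxQ hd).1 hl).le
    have h2 : ¬ Φ x = Φ q := fun he => hnot ((heq x hxQ hd).1 he).le
    exact lt_of_le_of_ne (not_lt.1 h1) (Ne.symm h2)
  · -- every non-exempt partner is on a line of `W`
    have hνx : ⟪x - q, ν⟫_ℝ < 0 ∨ (⟪x - q, ν⟫_ℝ = 0 ∧ x ∉ P) := by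
      by_cases hxP : x ∈ P
      · left; rw [inner_sub_left]; exact sub_neg.2 (hplug x hxP hd)
      · have hxR' : x ∈ Rset := by
          by_contra hxR'; exact hxR (mem_sdiff.2 ⟨mem_sdiff.2 ⟨hx, hxP⟩, hxR'⟩)
        rw [hRset] at hxR'
        have hle := (mem_filter.1 hxR').2
        rw [inner_sub_left]
        rcases hle.lt_or_eq with hl | he
        · left; exact sub_neg.2 hl
        · right; exact ⟨sub_eq_zero.2 he, hxP⟩
    by_cases huv : x - q = u - v ∨ x - q = -(u - v)
    · refine ⟨u - v, by rw [hW]; exact mem_insert_self _ _, ?_⟩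
      rcases huv with h | h
      · left; rw [← h]; abel
      · right; rw [show q - (u - v) = q + -(u - v) by abel, ← h]; abel
    push Not at huv
    rcases hνx with hneg | ⟨hzero, -⟩
    · refine ⟨x - q, ?_, Or.inl (by abel)⟩
      rw [hW]
      refine mem_insert_of_mem ?_
      rw [hWocc]
      exact mem_image.2 ⟨x, mem_filter.2 ⟨hx, hd, hneg, huv.1, huv.2⟩, rfl⟩
    · -- level: only `±(u − v)` can be level
      exfalso
      rcases hclass x hx hd with (h | h) | ⟨e, -, he1, he2, hxe⟩
      · exact huv.1 h
      · exact huv.2 h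
      · have hk := hkey e he1 he2
        rcases hxe with h | h
        · rw [h] at hzero; rw [hzero] at hk; simp at hk
        · rw [h, inner_neg_left, neg_eq_zero] at hzero; rw [hzero] at hk; simp at hk

end Summit.Ventures.Crystal3D.Theorems

end
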